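import Summits.ResolutionOfSingularities.ResolutionOfSingularities.Theorems.EquisingularLiftEquisingularLiftNatCompleteIntersectionLiftProj
import Summits.ResolutionOfSingularities.ResolutionOfSingularities.Theorems.EquisingularLiftEquisingularLiftNatDeltaCentreRegular
import HarnessLib

/-!
# [OURS · L1 W4.5(b) · EL♮(3) · NU7 §A2 «Σ1 SMOOTHING LEMMA», part 2b] GERMS OF DEHOMOGENISED FORMS ON `ℙⁿ_R`: values, units, and
# «the constant `ϖ` is a regular parameter of `𝒪_{ℙⁿ_O, x}` at every point of the special fibre»

res-L1-w45b-stub-2 g19 (STUB WORKER 2), desk RULING R70 (iii).  OURS; NOT a statement of any manuscript ([Hironaka2017] is a candidate under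
adjudication — nothing of it is asserted here); AI-written, weaker than expert review.  No `sorry`; standard axioms; DEF-FREE.
`--supports stmt-ResolutionOfSingularities-20148 --as helper`, counted 0.  EL♮(3) is NOT proved; resolution in positive characteristic is NOT proved.

WHAT.  For `ℙⁿ_R = Proj R[x₀..xₙ]`, a point `x ∈ D₊(x_d)` and a form `F` of degree `m`, write `Θ_x F := germ_x (awayToSection (F / x_d^m))`
(the stalk generators of ✓ `CILift.stalkIdeal_projIdealSheaf_span`):
* `val_stalkIso'_germ_mk₁` — under Mathlib's `Proj.stalkIso'`, `(Θ_x F) · x_d^m = F` in `R[x]_𝔭` (`𝔭` the homogeneous prime of `x`; the tree's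
  ✓ `CILift.val_stalkIso'_germ_awayToSection_mk₁` verbatim, for a general coefficient RING `R` instead of a field);
* `isUnit_germ_mk₁_of_notMem` / `germ_mk₁_mem_maximalIdeal_of_mem` — `Θ_x F` is a unit iff `F ∉ 𝔭`;
* `germ_mk₁_add`, `germ_mk₁_C_mul` — additivity, and `Θ_x (C r · F) = Θ_x (C r) · Θ_x F` (degree `0` constants);
* `algebraMap_C_varpi_notMem_sq` — for a DVR `O` with uniformizer `ϖ` and a prime `Q ∋ ϖ` of `O[x₀..xₙ]`: `ϖ ∉ 𝔪_Q²` in `O[x]_Q` (✓ `C_varpi_notMem_sq`,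
  res-L1-w45b Δ-centre toolkit D1, verbatim for `n + 1` variables);
* ★ `germ_C_varpi_notMem_sq` — hence `Θ_x (C ϖ) ∉ 𝔪_x²` in `𝒪_{ℙⁿ_O, x}` at every point `x` with `ϖ ∈ 𝔭_x` (the points of the special fibre).
References (method / index only): R. Hartshorne, *Algebraic Geometry* (1977), II Prop. 5.9; H. Matsumura, *Commutative Ring Theory* (1986), Thm. 14.2.
-/

set_option linter.dupNamespace false -- mandated namespace `Summit.<Summit>.<Problem>` of this single-conjunct summit
set_option linter.overlappingInstances false -- `[IsDomain O] [IsDiscreteValuationRing O]` (Mathlib's class takes the former as a parameter)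

noncomputable section

open CategoryTheory AlgebraicGeometry TopologicalSpace IsLocalRing
open MvPolynomial HomogeneousLocalization
open Literature.AlgebraicGeometry.Resolution
open Summit.ResolutionOfSingularities.ResolutionOfSingularities.Theorems

namespace Summit.ResolutionOfSingularities.ResolutionOfSingularities.Cruxes.EquisingularLiftNat.Sections.PlanarSmoothing

open Summit.ResolutionOfSingularities.ResolutionOfSingularities.Cruxes.EquisingularLiftNat.Sections

/-! ## Germs of dehomogenised forms: values and units -/

section Chart

variable {R : Type} [CommRing R] {n : ℕ} (d : Fin (n + 1))

/-- **The value of the germ of `F / x_d^m` at `x`**: `(Θ_x F) · x_d^m = F` in `R[x]_𝔭` (through Mathlib's `Proj.stalkIso'`). Copy of the tree's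
✓ `CILift.val_stalkIso'_germ_awayToSection_mk₁` for a general coefficient ring. [cite: Hartshorne1977, II Prop. 5.9 (proof)] -/
theorem val_stalkIso'_germ_mk₁ (m : ℕ) (F : MvPolynomial (Fin (n + 1)) R) (hF : F ∈ homogeneousSubmodule (Fin (n + 1)) R m) :
    letI := MvPolynomial.gradedAlgebra (σ := Fin (n + 1)) (R := R)
    ∀ (x : Proj (homogeneousSubmodule (Fin (n + 1)) R)) (hx : x ∈ Proj.basicOpen (homogeneousSubmodule (Fin (n + 1)) R) (X d)),
    (Proj.stalkIso' (homogeneousSubmodule (Fin (n + 1)) R) x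
        (((Proj (homogeneousSubmodule (Fin (n + 1)) R)).presheaf.germ (Proj.basicOpen (homogeneousSubmodule (Fin (n + 1)) R) (X d)) x hx).hom
          ((Proj.awayToSection (homogeneousSubmodule (Fin (n + 1)) R) (X d)).hom
            (mk₁ (homogeneousSubmodule (Fin (n + 1)) R) (CILift.X_mem_one' d) m F hF)))).val *
        algebraMap (MvPolynomial (Fin (n + 1)) R) (Localization.AtPrime x.asHomogeneousIdeal.toIdeal) (X d ^ m) =
      algebraMap (MvPolynomial (Fin (n + 1)) R) (Localization.AtPrime x.asHomogeneousIdeal.toIdeal) F := by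
  letI := MvPolynomial.gradedAlgebra (σ := Fin (n + 1)) (R := R)
  intro x hx
  have h := congrArg (fun ψ => ψ.hom (mk₁ (homogeneousSubmodule (Fin (n + 1)) R) (CILift.X_mem_one' d) m F hF))
    (ProjectiveSpectrum.Proj.awayToSection_germ (homogeneousSubmodule (Fin (n + 1)) R) (X d) x hx)
  simp only [CommRingCat.hom_comp, RingHom.comp_apply, CommRingCat.hom_ofHom] at h
  change (Proj.stalkIso' (homogeneousSubmodule (Fin (n + 1)) R) x
      (((ProjectiveSpectrum.Proj.awayToSection (homogeneousSubmodule (Fin (n + 1)) R) (X d)) ≫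
        (ProjectiveSpectrum.Proj.structureSheaf (homogeneousSubmodule (Fin (n + 1)) R)).presheaf.germ _ x hx).hom
          (mk₁ (homogeneousSubmodule (Fin (n + 1)) R) (CILift.X_mem_one' d) m F hF))).val * _ = _
  rw [ProjectiveSpectrum.Proj.awayToSection_germ]
  change (Proj.stalkIso' (homogeneousSubmodule (Fin (n + 1)) R) x
      ((Proj.stalkIso' (homogeneousSubmodule (Fin (n + 1)) R) x).toCommRingCatIso.inv.hom
        (HomogeneousLocalization.mapId (homogeneousSubmodule (Fin (n + 1)) R) (Submonoid.powers_le.mpr hx)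
          (mk₁ (homogeneousSubmodule (Fin (n + 1)) R) (CILift.X_mem_one' d) m F hF)))).val * _ = _
  have hinv : ∀ z, Proj.stalkIso' (homogeneousSubmodule (Fin (n + 1)) R) x
      ((Proj.stalkIso' (homogeneousSubmodule (Fin (n + 1)) R) x).toCommRingCatIso.inv.hom z) = z :=
    fun z => (Proj.stalkIso' (homogeneousSubmodule (Fin (n + 1)) R) x).apply_symm_apply z
  rw [hinv, mk₁, HomogeneousLocalization.Away.mk, HomogeneousLocalization.map_mk, HomogeneousLocalization.val_mk,
    Localization.mk_eq_mk']
  exact IsLocalization.mk'_spec _ _ _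

/-- **`Θ_x F` is a unit when `F ∉ 𝔭_x`.** [folklore] -/
theorem isUnit_germ_mk₁_of_notMem (m : ℕ) (F : MvPolynomial (Fin (n + 1)) R) (hF : F ∈ homogeneousSubmodule (Fin (n + 1)) R m) :
    letI := MvPolynomial.gradedAlgebra (σ := Fin (n + 1)) (R := R)
    ∀ (x : Proj (homogeneousSubmodule (Fin (n + 1)) R)) (hx : x ∈ Proj.basicOpen (homogeneousSubmodule (Fin (n + 1)) R) (X d)),
    F ∉ x.asHomogeneousIdeal →
    IsUnit (((Proj (homogeneousSubmodule (Fin (n + 1)) R)).presheaf.germ (Proj.basicOpen (homogeneousSubmodule (Fin (n + 1)) R) (X d)) x hx).hom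
      ((Proj.awayToSection (homogeneousSubmodule (Fin (n + 1)) R) (X d)).hom
        (mk₁ (homogeneousSubmodule (Fin (n + 1)) R) (CILift.X_mem_one' d) m F hF))) := by
  letI := MvPolynomial.gradedAlgebra (σ := Fin (n + 1)) (R := R)
  intro x hx hFx
  haveI : x.asHomogeneousIdeal.toIdeal.IsPrime := x.isPrime
  have hval := val_stalkIso'_germ_mk₁ d m F hF x hx
  have hFu : IsUnit (algebraMap (MvPolynomial (Fin (n + 1)) R) (Localization.AtPrime x.asHomogeneousIdeal.toIdeal) F) :=
    IsLocalization.map_units _ (⟨F, show F ∈ x.asHomogeneousIdeal.toIdeal.primeCompl from hFx⟩ : x.asHomogeneousIdeal.toIdeal.primeCompl)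
  rw [← hval] at hFu
  have hv := (HomogeneousLocalization.isUnit_iff_isUnit_val _ _ _).mp (isUnit_of_mul_isUnit_left hFu)
  exact (MulEquiv.isUnit_map (Proj.stalkIso' (homogeneousSubmodule (Fin (n + 1)) R) x)).mp hv

/-- **`Θ_x F ∈ 𝔪_x` when `F ∈ 𝔭_x`.** [folklore] -/
theorem germ_mk₁_mem_maximalIdeal_of_mem (m : ℕ) (F : MvPolynomial (Fin (n + 1)) R) (hF : F ∈ homogeneousSubmodule (Fin (n + 1)) R m) :
    letI := MvPolynomial.gradedAlgebra (σ := Fin (n + 1)) (R := R)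
    ∀ (x : Proj (homogeneousSubmodule (Fin (n + 1)) R)) (hx : x ∈ Proj.basicOpen (homogeneousSubmodule (Fin (n + 1)) R) (X d)),
    F ∈ x.asHomogeneousIdeal →
    ((Proj (homogeneousSubmodule (Fin (n + 1)) R)).presheaf.germ (Proj.basicOpen (homogeneousSubmodule (Fin (n + 1)) R) (X d)) x hx).hom
      ((Proj.awayToSection (homogeneousSubmodule (Fin (n + 1)) R) (X d)).hom
        (mk₁ (homogeneousSubmodule (Fin (n + 1)) R) (CILift.X_mem_one' d) m F hF)) ∈
      maximalIdeal ((Proj (homogeneousSubmodule (Fin (n + 1)) R)).presheaf.stalk x) := by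
  letI := MvPolynomial.gradedAlgebra (σ := Fin (n + 1)) (R := R)
  intro x hx hFx
  haveI : x.asHomogeneousIdeal.toIdeal.IsPrime := x.isPrime
  rw [mem_maximalIdeal, mem_nonunits_iff]
  intro hu
  have hv := (HomogeneousLocalization.isUnit_iff_isUnit_val _ _ _).mpr
    ((MulEquiv.isUnit_map (Proj.stalkIso' (homogeneousSubmodule (Fin (n + 1)) R) x)).mpr hu)
  have hXu : IsUnit (algebraMap (MvPolynomial (Fin (n + 1)) R) (Localization.AtPrime x.asHomogeneousIdeal.toIdeal) (X d ^ m)) :=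
    IsLocalization.map_units _ (⟨X d ^ m, show X d ^ m ∈ x.asHomogeneousIdeal.toIdeal.primeCompl from
      fun h => hx (x.isPrime.mem_of_pow_mem m h)⟩ : x.asHomogeneousIdeal.toIdeal.primeCompl)
  have hFu := hv.mul hXu
  rw [val_stalkIso'_germ_mk₁ d m F hF x hx, IsLocalization.AtPrime.isUnit_to_map_iff (Localization.AtPrime x.asHomogeneousIdeal.toIdeal)
    x.asHomogeneousIdeal.toIdeal F] at hFu
  exact hFu hFx

/-- `Θ_x (F + G) = Θ_x F + Θ_x G` (same degree). [folklore] -/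
theorem germ_mk₁_add (m : ℕ) (F G : MvPolynomial (Fin (n + 1)) R) (hF : F ∈ homogeneousSubmodule (Fin (n + 1)) R m)
    (hG : G ∈ homogeneousSubmodule (Fin (n + 1)) R m) :
    letI := MvPolynomial.gradedAlgebra (σ := Fin (n + 1)) (R := R)
    ∀ (x : Proj (homogeneousSubmodule (Fin (n + 1)) R)) (hx : x ∈ Proj.basicOpen (homogeneousSubmodule (Fin (n + 1)) R) (X d)),
    ((Proj (homogeneousSubmodule (Fin (n + 1)) R)).presheaf.germ (Proj.basicOpen (homogeneousSubmodule (Fin (n + 1)) R) (X d)) x hx).hom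
      ((Proj.awayToSection (homogeneousSubmodule (Fin (n + 1)) R) (X d)).hom
        (mk₁ (homogeneousSubmodule (Fin (n + 1)) R) (CILift.X_mem_one' d) m (F + G) (add_mem hF hG))) =
    ((Proj (homogeneousSubmodule (Fin (n + 1)) R)).presheaf.germ (Proj.basicOpen (homogeneousSubmodule (Fin (n + 1)) R) (X d)) x hx).hom
      ((Proj.awayToSection (homogeneousSubmodule (Fin (n + 1)) R) (X d)).hom
        (mk₁ (homogeneousSubmodule (Fin (n + 1)) R) (CILift.X_mem_one' d) m F hF)) +
    ((Proj (homogeneousSubmodule (Fin (n + 1)) R)).presheaf.germ (Proj.basicOpen (homogeneousSubmodule (Fin (n + 1)) R) (X d)) x hx).hom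
      ((Proj.awayToSection (homogeneousSubmodule (Fin (n + 1)) R) (X d)).hom
        (mk₁ (homogeneousSubmodule (Fin (n + 1)) R) (CILift.X_mem_one' d) m G hG)) := by
  letI := MvPolynomial.gradedAlgebra (σ := Fin (n + 1)) (R := R)
  intro x hx
  rw [mk₁_add, map_add, map_add]

/-- `Θ_x (C r · F) = Θ_x (C r) · Θ_x F` (a constant is a form of degree `0`). [folklore] -/
theorem germ_mk₁_C_mul (m : ℕ) (r : R) (F : MvPolynomial (Fin (n + 1)) R) (hF : F ∈ homogeneousSubmodule (Fin (n + 1)) R m)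
    (hCF : C r * F ∈ homogeneousSubmodule (Fin (n + 1)) R m) :
    letI := MvPolynomial.gradedAlgebra (σ := Fin (n + 1)) (R := R)
    ∀ (x : Proj (homogeneousSubmodule (Fin (n + 1)) R)) (hx : x ∈ Proj.basicOpen (homogeneousSubmodule (Fin (n + 1)) R) (X d)),
    ((Proj (homogeneousSubmodule (Fin (n + 1)) R)).presheaf.germ (Proj.basicOpen (homogeneousSubmodule (Fin (n + 1)) R) (X d)) x hx).hom
      ((Proj.awayToSection (homogeneousSubmodule (Fin (n + 1)) R) (X d)).hom
        (mk₁ (homogeneousSubmodule (Fin (n + 1)) R) (CILift.X_mem_one' d) m (C r * F) hCF)) =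
    ((Proj (homogeneousSubmodule (Fin (n + 1)) R)).presheaf.germ (Proj.basicOpen (homogeneousSubmodule (Fin (n + 1)) R) (X d)) x hx).hom
      ((Proj.awayToSection (homogeneousSubmodule (Fin (n + 1)) R) (X d)).hom
        (mk₁ (homogeneousSubmodule (Fin (n + 1)) R) (CILift.X_mem_one' d) 0 (C r) (isHomogeneous_C _ r))) *
    ((Proj (homogeneousSubmodule (Fin (n + 1)) R)).presheaf.germ (Proj.basicOpen (homogeneousSubmodule (Fin (n + 1)) R) (X d)) x hx).hom
      ((Proj.awayToSection (homogeneousSubmodule (Fin (n + 1)) R) (X d)).hom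
        (mk₁ (homogeneousSubmodule (Fin (n + 1)) R) (CILift.X_mem_one' d) m F hF)) := by
  letI := MvPolynomial.gradedAlgebra (σ := Fin (n + 1)) (R := R)
  intro x hx
  rw [← map_mul, ← map_mul]
  congr 2
  have h := mk₁_mul (homogeneousSubmodule (Fin (n + 1)) R) (CILift.X_mem_one' d) (Nat.zero_le m) (C r) F (isHomogeneous_C _ r) hF
  exact (mk₁_congr _ _ rfl _ _).trans h

end Chart

/-! ## The constant `ϖ` is a regular parameter at the points of the special fibre -/

section Varpi

variable {O : Type} [CommRing O] [IsDomain O] [IsDiscreteValuationRing O] {ϖ : O} {n : ℕ}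

/-- For a prime `Q ∋ ϖ` of `A = O[x₀..xₙ]`: `A_Q/(ϖ) ≅ (k[x])_𝔮` is a regular local ring (✓ `isRegularLocalRing_localization_quotient_C`
verbatim for `n + 1` variables). [folklore] -/
theorem isRegularLocalRing_localization_quotient_C' (hϖ : Irreducible ϖ)
    (Q : Ideal (MvPolynomial (Fin (n + 1)) O)) [Q.IsPrime] (hQ : (C ϖ : MvPolynomial (Fin (n + 1)) O) ∈ Q) :
    IsRegularLocalRing (Localization.AtPrime Q ⧸
      Ideal.span {algebraMap (MvPolynomial (Fin (n + 1)) O) (Localization.AtPrime Q) (C ϖ)}) := by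
  set A := MvPolynomial (Fin (n + 1)) O with hA
  set J : Ideal A := (Ideal.span {ϖ}).map (C : O →+* A) with hJdef
  have hJ : J = Ideal.span {(C ϖ : A)} := by rw [hJdef, Ideal.map_span, Set.image_singleton]
  have hJQ : J ≤ Q := by rw [hJ, Ideal.span_singleton_le_iff_mem]; exact hQ
  obtain ⟨hprime, hcomap⟩ := isPrime_map_mk_and_comap_eq J Q hJQ
  haveI := hprime
  haveI hmax : (Ideal.span {ϖ}).IsMaximal := PrincipalIdealRing.isMaximal_of_irreducible hϖ
  letI : Field (O ⧸ Ideal.span {ϖ}) := Ideal.Quotient.field _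
  haveI : IsRegularRing (A ⧸ J) :=
    IsRegularRing.of_ringEquiv
      (MvPolynomial.quotientEquivQuotientMvPolynomial (σ := Fin (n + 1)) (Ideal.span {ϖ})).toRingEquiv
  have h1 : IsRegularLocalRing (Localization.AtPrime (Q.map (Ideal.Quotient.mk J))) :=
    IsRegularRing.isRegularLocalRing_localization _
  have h2 := (isRegularLocalRing_localization_quotient_iff J Q (Q.map (Ideal.Quotient.mk J))
    hcomap).mp h1
  have hJ' : J.map (algebraMap A (Localization.AtPrime Q)) =
      Ideal.span {algebraMap A (Localization.AtPrime Q) (C ϖ)} := by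
    rw [hJ, Ideal.map_span, Set.image_singleton]
  rw [hJ'] at h2
  exact h2

/-- For a prime `Q ∋ ϖ` of `O[x₀..xₙ]`: `ϖ ∉ 𝔪_Q²` in the regular local ring `O[x]_Q` (✓ `C_varpi_notMem_sq` verbatim for `n + 1` variables).
[folklore] -/
theorem algebraMap_C_varpi_notMem_sq (hϖ : Irreducible ϖ)
    (Q : Ideal (MvPolynomial (Fin (n + 1)) O)) [Q.IsPrime] (hQ : (C ϖ : MvPolynomial (Fin (n + 1)) O) ∈ Q) :
    algebraMap (MvPolynomial (Fin (n + 1)) O) (Localization.AtPrime Q) (C ϖ) ∉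
      maximalIdeal (Localization.AtPrime Q) ^ 2 := by
  set A := MvPolynomial (Fin (n + 1)) O with hA
  set L := Localization.AtPrime Q with hL
  haveI : IsRegularLocalRing L := IsRegularRing.isRegularLocalRing_localization Q
  have hmem : algebraMap A L (C ϖ) ∈ maximalIdeal L := by
    rw [← Localization.AtPrime.map_eq_maximalIdeal]
    exact Ideal.mem_map_of_mem _ hQ
  have hinj : Function.Injective (algebraMap A L) :=
    IsLocalization.injective L Q.primeCompl_le_nonZeroDivisors
  have hne : algebraMap A L (C ϖ) ≠ 0 := by
    rw [Ne, ← map_zero (algebraMap A L), hinj.eq_iff, MvPolynomial.C_eq_zero]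
    exact hϖ.ne_zero
  have hreg : IsSMulRegular L (algebraMap A L (C ϖ)) :=
    (IsRegular.of_ne_zero hne).left.isSMulRegular
  exact not_mem_sq_of_isRegularLocalRing_quotient hmem hreg
    (isRegularLocalRing_localization_quotient_C' hϖ Q hQ)

/-- ★ **The constant `ϖ` is a regular parameter of `𝒪_{ℙⁿ_O, x}` at every point of the special fibre**: for `x ∈ D₊(x_d)` with `ϖ ∈ 𝔭_x`,
`Θ_x (C ϖ) ∉ 𝔪_x²` (transport along `Proj.stalkIso'`, whose `val` into `O[x]_𝔭` is a local homomorphism, and `algebraMap_C_varpi_notMem_sq`).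
[cite: Matsumura1987, Thm. 14.2] [OURS · NU7 §A2 part 2b] -/
theorem germ_C_varpi_notMem_sq (hϖ : Irreducible ϖ) (d : Fin (n + 1)) :
    letI := MvPolynomial.gradedAlgebra (σ := Fin (n + 1)) (R := O)
    ∀ (x : Proj (homogeneousSubmodule (Fin (n + 1)) O)) (hx : x ∈ Proj.basicOpen (homogeneousSubmodule (Fin (n + 1)) O) (X d)),
    (C ϖ : MvPolynomial (Fin (n + 1)) O) ∈ x.asHomogeneousIdeal →
    ((Proj (homogeneousSubmodule (Fin (n + 1)) O)).presheaf.germ (Proj.basicOpen (homogeneousSubmodule (Fin (n + 1)) O) (X d)) x hx).hom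
      ((Proj.awayToSection (homogeneousSubmodule (Fin (n + 1)) O) (X d)).hom
        (mk₁ (homogeneousSubmodule (Fin (n + 1)) O) (CILift.X_mem_one' d) 0 (C ϖ) (isHomogeneous_C _ ϖ))) ∉
      maximalIdeal ((Proj (homogeneousSubmodule (Fin (n + 1)) O)).presheaf.stalk x) ^ 2 := by
  letI := MvPolynomial.gradedAlgebra (σ := Fin (n + 1)) (R := O)
  intro x hx hxϖ
  haveI : x.asHomogeneousIdeal.toIdeal.IsPrime := x.isPrime
  intro hmem
  -- transport along `ε = stalkIso'` and then `val` (both local homomorphisms)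
  let ε : ((Proj (homogeneousSubmodule (Fin (n + 1)) O)).presheaf.stalk x) ≃+*
      HomogeneousLocalization.AtPrime (homogeneousSubmodule (Fin (n + 1)) O) x.asHomogeneousIdeal.toIdeal :=
    Proj.stalkIso' (homogeneousSubmodule (Fin (n + 1)) O) x
  let v : HomogeneousLocalization.AtPrime (homogeneousSubmodule (Fin (n + 1)) O) x.asHomogeneousIdeal.toIdeal →+*
      Localization.AtPrime x.asHomogeneousIdeal.toIdeal := algebraMap _ _
  have hv : ∀ z, v z = z.val := fun z => HomogeneousLocalization.algebraMap_apply z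
  -- `v ∘ ε` maps `𝔪_x` into `𝔪`
  have hle : maximalIdeal ((Proj (homogeneousSubmodule (Fin (n + 1)) O)).presheaf.stalk x) ≤
      (maximalIdeal (Localization.AtPrime x.asHomogeneousIdeal.toIdeal)).comap (v.comp ε.toRingHom) := by
    intro z hz
    rw [Ideal.mem_comap, mem_maximalIdeal, mem_nonunits_iff]
    rw [mem_maximalIdeal, mem_nonunits_iff] at hz
    intro hu
    apply hz
    have hu' : IsUnit (ε z).val := by rw [← hv]; exact hu
    exact (MulEquiv.isUnit_map ε).mp ((HomogeneousLocalization.isUnit_iff_isUnit_val _ _ _).mp hu')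
  have h1 := Ideal.le_comap_pow _ 2 (Ideal.pow_right_mono hle 2 hmem)
  rw [Ideal.mem_comap] at h1
  -- the value is `algebraMap (C ϖ)`
  have hval := val_stalkIso'_germ_mk₁ d 0 (C ϖ) (isHomogeneous_C _ ϖ) x hx
  rw [pow_zero, map_one, mul_one] at hval
  have h2 : (v.comp ε.toRingHom) (((Proj (homogeneousSubmodule (Fin (n + 1)) O)).presheaf.germ
      (Proj.basicOpen (homogeneousSubmodule (Fin (n + 1)) O) (X d)) x hx).hom
      ((Proj.awayToSection (homogeneousSubmodule (Fin (n + 1)) O) (X d)).hom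
        (mk₁ (homogeneousSubmodule (Fin (n + 1)) O) (CILift.X_mem_one' d) 0 (C ϖ) (isHomogeneous_C _ ϖ)))) =
      algebraMap (MvPolynomial (Fin (n + 1)) O) (Localization.AtPrime x.asHomogeneousIdeal.toIdeal) (C ϖ) := hval
  rw [h2] at h1
  exact algebraMap_C_varpi_notMem_sq hϖ x.asHomogeneousIdeal.toIdeal hxϖ h1

end Varpi

end Summit.ResolutionOfSingularities.ResolutionOfSingularities.Cruxes.EquisingularLiftNat.Sections.PlanarSmoothing

end
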